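import Summits.QuantumFields.YangMills.Theorems.BalabanUVNodesK2JsOfRecord
import Literature.MathematicalPhysics.QuantumFieldTheory.Balaban1983to89.Beta.RemainderChain
import Literature.MathematicalPhysics.QuantumFieldTheory.Balaban1983to89.Node00.Record13SepCoPH

/-!
# Crux K2⁷ `EndpointGivenBR13SepCoPH` (stmt-QuantumFields-20543), skeleton v3 LINE 1′ «named jets» — THE PRICE OF ITS g-PROPORTIONAL REMAINDER:
# the END reads `BoxRemainder … C_r` only through the CONSTANT `C_r·γ₀ ≤ stepBal`, and the IDENTIFICATION only through a PER-SCALE ANCHOR; so stub 2′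
# `RemAtSomeJets` can be cut at print's CONSTANT-form grade (`|β_{k+1} − b_k| ≤ s`, `s ≤ stepBal 2 L`, + per-scale anchor) with the same composition

Cell `pub-balaban`, BINDER row D4 OWNER lineage `b2b-balaban-beta-an4` (gen 151; β-FLOW TEAM (1); line: 20543 per director-ym D-0145), a COUNT-NEUTRAL pricing certificate
for the planner of record (pub-ymgap plan g80 `[YMPLAN-G80-K2V3-REGISTERED bdd723a03d543770]`: LINE 1′ = ym-nodeO DEF-1's reshape (R-b) over `Thm/BalabanUVNodesK2JsOfRecord`
p588621, stubs `stub_d1NamedJets13 : D1AtShadowingJets`, `stub_remNamedJets13 : RemAtSomeJets` (XL), shared letter `RemAt F κ θ hP` whose analytic core is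
`BoxRemainder β (beta0OfJs F κ) C_r γ₀` = «`|β_{k+1}(p) − b_k| ≤ C_r·p_k` on `]0, γ₀]`-histories», a bound LINEAR in the last coupling).

ROW (D4)'s LOCATED RECORD (cell pub-balaban `BETA/AN4.md` v1.2, 2026-08-18, §4 (P1) + `BETA-SPEC.md` §4 (AF-1w); unchanged since): the LINEAR form `|β¹_{k+1}| ≤ C·g_k` is NOT
what the printed chain [II] (2.41)+R22 → [I] (4.2)–(4.5), (4.35), (4.37) → (5.10) → (1.22) delivers — that chain gives the CONSTANT form `|β¹_{k+1}| ≤ ε₁·K_rem` (k-uniform, history-free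
constant; the tree's `Beta.RemainderChain.RemainderConst`, the (190)-chain `AtSlope`∕`AtSlopeCont` currency of the dropped line 1), while `O(g_k)` precision needs the un-printed g-derivative
clause (1.18-∂) ∕ the cubic-insertion estimate (P1) of [II] §2.  Hence a stub in LINEAR form sits one located estimate ABOVE print's chain.  THIS FILE shows the line does not need it:
* §1 `betaPartialSumsLowerH_of_drift_lowerRemainder` ∕ ★ `endpointExistence_of_drift_constRemainder`: DEF-1's END (`endpointExistence_of_drift_boxRemainder`) re-run from the CONSTANT
  (indeed one-sided) form `b_k − s ≤ β_{k+1}(p)` on the box with the seam `s ≤` drift slope — its proof reads `BoxRemainder` only through `C_r·p_k ≤ C_r·γ₀ ≤ s`;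
  `constRemainder_of_boxRemainder` (linear ⟹ constant with `s := C_r γ₀`); `constRemainder_of_remainderConst` (the dropped line 1's `RemainderConst S γ r` IS the constant form
  relative to `S.β0` — so the (190)-chain ∕ NODE-D road of this lineage feeds the constant-form cut, not the linear one).
* §2 ★ `eq_of_anchors`: the IDENTIFICATION «the shadowed numbers are unique» (`boxRemainder_unique`) needs only a PER-SCALE ANCHOR «∀ k δ>0 ∃ γ>0, |β_{k+1} − b_k| ≤ δ on ]0,γ]^{k+1}»
  (line 2's S2 `AnchorVanishing` shape, [I] (2.13) p. 268 «vanishes at g_k = 0» read per scale — fixed-cutoff grade modulo the volume-limit proviso), which the linear form implies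
  (`anchor_of_boxRemainder`) and the constant form does not.
* §3 AT THE RECORD (texts spelled inline, N = 2, `Stage13HParams`, v1.7 SepCoPH provisos): the constant-form package `RemAtC` (box, `0 ≤ s ≤ stepBal 2 F.L`, constant remainder,
  per-scale anchor, (C), upper bound) — `remAtC_of_remAt` (v3's `RemAt` text ⟹ it: the proposed stub 2″ is WEAKER than the registered 2′), `beta0OfJs_eq_of_remAtC` (identification
  survives), ★★ `EndpointGivenBR13SepCoPH_text_of_line1C` (K2⁷'s TEXT from {1″: `D1AtShadowingJetsC`, 2″: `RemAtCSomeJets`} — the same composition), `d1AtShadowingJetsC_of_d1Drift_all`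
  (1″ has the same (D1) discharge road as 1′).  OPTION for a v4 (plan's call, zero hold): replace `RemAt` by the constant-form package in both line-1′ stubs — one located estimate cheaper
  on the (D4) side ((P1) off the path), nothing lost on the END or the identification.

HONEST FRAMING.  Bookkeeping ∕ pricing over the typed objects; every package here is a HYPOTHESIS SHAPE inhabited at no θ (instance 0∕1); NOTHING of Bałaban's analysis is asserted;
NOT a proof of any registered stub; K2⁷ ∕ N25 ∕ N26 NOT discharged; (D4) NOT discharged (critical-path width 0 = NODE O; D4 DISCHARGE NO DATE); counts unmoved; one finite four-torus
programme at fixed ε per run — NOT the continuum limit, NOT ℝ⁴, NOT OS, NOT a mass gap, NOT Clay.  No `def` (packages spelled inline), no `instance`, no `notation`, no `axiom`.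
Sources (context only): [I] = [Balaban1987RG1] CMP **109** (1987): Thm 2 p. 259 (first sentence), (1.18) p. 263, (1.20)–(1.22) p. 264, (2.12)–(2.14) p. 268, (4.37) p. 282, (5.10)
p. 293; [II] = [Balaban1988RG2Cluster] CMP **116** (1988): (1.38)–(1.40) pp. 10–11, Lemma 3 (2.38) p. 20, (2.41) p. 21.
-/

noncomputable section

open scoped Matrix.Norms.L2Operator

namespace Summit.QuantumFields.YangMills.Theorems.BalabanUVNodesK2Line1PrimeRemainderPrice

open Finset
open scoped BigOperators
open Literature.MathematicalPhysics.QuantumFieldTheory.Balaban1983to89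
open Literature.MathematicalPhysics.QuantumFieldTheory.Balaban1983to89.FlowStep
open Literature.MathematicalPhysics.QuantumFieldTheory.Balaban1983to89.FlowStepRuns (BetaPartialSumsLowerH endpointExistence_of_partialSums)
open Literature.MathematicalPhysics.QuantumFieldTheory.Balaban1983to89.DagBinding (EndpointExistence ForwardGenerated)
open Literature.MathematicalPhysics.QuantumFieldTheory.Balaban1983to89.T4Continuum (T4Family)
open Literature.MathematicalPhysics.QuantumFieldTheory.Balaban1983to89.B12Beta (HistBox)
open Literature.MathematicalPhysics.QuantumFieldTheory.Balaban1983to89.Node00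
open Literature.MathematicalPhysics.QuantumFieldTheory.Balaban1983to89.Beta.Drift (OneLoopDrift sum_Ico_ge_of_drift)
open Literature.MathematicalPhysics.QuantumFieldTheory.Balaban1983to89.Beta.RemainderChain (RemainderConst)
open Summit.QuantumFields.YangMills.Theorems.BalabanUVNodesK2JsOfRecord
  (StepColourData JsOfRecord beta0OfJs BoxRemainder endpointExistence_of_drift_boxRemainder)

/-! ## §1 The END needs only the CONSTANT (indeed one-sided) remainder with the seam `s ≤` drift slope -/

section Generic

variable {β : HBeta} {b : ℕ → ℝ}

/-- **(A-ps) FROM A DRIFT AND A ONE-SIDED CONSTANT REMAINDER.**  If `b` drifts with slope `s` up to the defect `A` and `b_k − s ≤ β_{k+1}(p)` on every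
`]0, γ₀]`-history, the partial sums of `β` along `]0, γ₀]`-histories are `≥ −2A` — DEF-1's `betaPartialSumsLowerH_of_drift_boxRemainder` with its only use of the
linear bound (`C_r·p_k ≤ C_r·γ₀ ≤ s`) replaced by the hypothesis it produces.  No sign of `s`, no split, no convergence. [folklore] -/
theorem betaPartialSumsLowerH_of_drift_lowerRemainder {s A γ₀ : ℝ} (hdrift : OneLoopDrift s A b)
    (hrem : ∀ (k : ℕ) (p : Fin (k + 1) → ℝ), p ∈ HistBox γ₀ k → b k - s ≤ β k p) : BetaPartialSumsLowerH (2 * A) γ₀ β := by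
  intro g hg k n hkn
  have hstep : ∀ j, b j - s ≤ β j (prefixOf g j) := fun j => hrem j _ fun i => hg i
  have hsum : ∑ j ∈ Finset.Ico k n, (b j - s) ≤ ∑ j ∈ Finset.Ico k n, β j (prefixOf g j) :=
    Finset.sum_le_sum fun j _ => hstep j
  have hsplit : ∑ j ∈ Finset.Ico k n, (b j - s) = ∑ j ∈ Finset.Ico k n, b j - s * ((n : ℝ) - k) := by
    rw [Finset.sum_sub_distrib, Finset.sum_const, Nat.card_Ico, nsmul_eq_mul, Nat.cast_sub hkn]
    ring
  have hdr := sum_Ico_ge_of_drift hdrift hkn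
  linarith

/-- **★ ENDPOINT EXISTENCE FROM A DRIFT AND A CONSTANT-FORM REMAINDER** (forward-generated constructions): `OneLoopDrift s A b`, `|β_{k+1}(p) − b_k| ≤ r` on
`]0, γ₀]`-histories with the seam `r ≤ s`, (C) and the printed upper bound on the box ⇒ `EndpointExistence C` — print's CONSTANT-form grade of rows (D4) ∧ B4
([II] (2.41) → [I] (5.10) → (1.22): `r = ε₁·K_rem`), no `O(g_k)` precision. [cite: Balaban1987RG1, Thm 2 p.259 (first sentence) and (5.10) p.293] -/
theorem endpointExistence_of_drift_constRemainder {C : B12.Construction} (hgen : ForwardGenerated C β) {γ₀ s A r β' : ℝ} (hγ₀ : 0 < γ₀)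
    (hdrift : OneLoopDrift s A b) (hrem : ∀ (k : ℕ) (p : Fin (k + 1) → ℝ), p ∈ HistBox γ₀ k → |β k p - b k| ≤ r) (hseam : r ≤ s)
    (hβ' : 0 ≤ β') (hcont : BetaContH γ₀ β) (hup : BetaUpperH β' γ₀ β) : EndpointExistence C :=
  endpointExistence_of_partialSums hgen hγ₀ (by linarith [hdrift.nonneg]) hβ' hcont
    (betaPartialSumsLowerH_of_drift_lowerRemainder hdrift fun k p hp => by
      have h := (abs_le.mp (hrem k p hp)).1
      linarith) hup

/-- LINEAR ⟹ CONSTANT: a `BoxRemainder` with `0 ≤ C_r` is a constant-form remainder with `r := C_r γ₀` — the ONLY way DEF-1's END reads it. [folklore] -/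
theorem constRemainder_of_boxRemainder {Cr γ₀ : ℝ} (h : BoxRemainder β b Cr γ₀) (hCr : 0 ≤ Cr) :
    ∀ (k : ℕ) (p : Fin (k + 1) → ℝ), p ∈ HistBox γ₀ k → |β k p - b k| ≤ Cr * γ₀ :=
  fun k p hp => (h k p hp).trans (mul_le_mul_of_nonneg_left (hp (Fin.last k)).2 hCr)

/-- THE DROPPED LINE 1's CURRENCY IS THE CONSTANT FORM: `Beta.RemainderChain.RemainderConst S γ r` (`|β¹_{k+1}| ≤ r` on the boxes, the (190)-chain's output
`remainderConst_of_atSlope` with `r = ε₁·K_rem,L`) is `|β_{k+1}(p) − β⁰_{k+1}| ≤ r` relative to the split's one-loop numbers. [cite: Balaban1987RG1, (5.10) p.293 and (1.22) p.264] -/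
theorem constRemainder_of_remainderConst (S : B12Beta.OneLoopSplit β) {γ r : ℝ} (h : RemainderConst S γ r) :
    ∀ (k : ℕ) (p : Fin (k + 1) → ℝ), p ∈ HistBox γ k → |β k p - S.β0 k| ≤ r := fun k p hp => by
  have e : β k p - S.β0 k = S.β1 k p := by rw [S.split k p]; ring
  rw [e]
  exact h k p hp

/-! ## §2 The IDENTIFICATION needs only a per-scale anchor -/

/-- **★ TWO PER-SCALE ANCHORS AT THE SAME β HAVE THE SAME NUMBERS**: if for every `k` and `δ > 0` the function `β_{k+1}` is within `δ` of `b_k` on SOME box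
`]0, γ]^{k+1}` and within `δ` of `b′_k` on some box, then `b = b′` (evaluate at a constant history in both boxes).  DEF-1's `boxRemainder_unique` with its only use
of the linear bound replaced by what it yields; the anchor is line 2's S2 shape read relative to `b`. [folklore] -/
theorem eq_of_anchors {b' : ℕ → ℝ}
    (h : ∀ (k : ℕ) (δ : ℝ), 0 < δ → ∃ γ : ℝ, 0 < γ ∧ ∀ p : Fin (k + 1) → ℝ, p ∈ HistBox γ k → |β k p - b k| ≤ δ)
    (h' : ∀ (k : ℕ) (δ : ℝ), 0 < δ → ∃ γ : ℝ, 0 < γ ∧ ∀ p : Fin (k + 1) → ℝ, p ∈ HistBox γ k → |β k p - b' k| ≤ δ) : b = b' := by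
  funext k
  by_contra hne
  have hε : 0 < |b k - b' k| := abs_pos.mpr (sub_ne_zero.mpr hne)
  obtain ⟨γ, hγ, hb⟩ := h k (|b k - b' k| / 4) (by positivity)
  obtain ⟨γ', hγ', hb'⟩ := h' k (|b k - b' k| / 4) (by positivity)
  set p : Fin (k + 1) → ℝ := fun _ => min γ γ' with hp
  have hpγ : p ∈ HistBox γ k := fun _ => ⟨lt_min hγ hγ', min_le_left _ _⟩
  have hpγ' : p ∈ HistBox γ' k := fun _ => ⟨lt_min hγ hγ', min_le_right _ _⟩
  have h1 := hb p hpγ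
  have h2 := hb' p hpγ'
  have htri : |b k - b' k| ≤ |β k p - b k| + |β k p - b' k| := by
    calc |b k - b' k| = |(β k p - b' k) - (β k p - b k)| := by ring_nf
      _ ≤ |β k p - b' k| + |β k p - b k| := abs_sub _ _
      _ = |β k p - b k| + |β k p - b' k| := add_comm _ _
  linarith

/-- LINEAR ⟹ ANCHOR: a `BoxRemainder` with `0 ≤ C_r` on a box `0 < γ₀` anchors `β` at `b` scale by scale (`γ := min γ₀ (δ∕(C_r+1))`). [folklore] -/
theorem anchor_of_boxRemainder {Cr γ₀ : ℝ} (h : BoxRemainder β b Cr γ₀) (hCr : 0 ≤ Cr) (hγ₀ : 0 < γ₀) :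
    ∀ (k : ℕ) (δ : ℝ), 0 < δ → ∃ γ : ℝ, 0 < γ ∧ ∀ p : Fin (k + 1) → ℝ, p ∈ HistBox γ k → |β k p - b k| ≤ δ := by
  intro k δ hδ
  refine ⟨min γ₀ (δ / (Cr + 1)), lt_min hγ₀ (by positivity), fun p hp => ?_⟩
  have hpγ₀ : p ∈ HistBox γ₀ k := fun i => ⟨(hp i).1, (hp i).2.trans (min_le_left _ _)⟩
  have hlast : p (Fin.last k) ≤ δ / (Cr + 1) := (hp (Fin.last k)).2.trans (min_le_right _ _)
  have hCr1 : 0 < Cr + 1 := by linarith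
  calc |β k p - b k| ≤ Cr * p (Fin.last k) := h k p hpγ₀
    _ ≤ Cr * (δ / (Cr + 1)) := mul_le_mul_of_nonneg_left hlast hCr
    _ ≤ (Cr + 1) * (δ / (Cr + 1)) := mul_le_mul_of_nonneg_right (by linarith) (by positivity)
    _ = δ := by field_simp

end Generic

/-! ## §3 At NODE 00's Stage-13 record (N = 2): the CONSTANT-FORM package `RemAtC`, spelled inline; v3's `RemAt` ⟹ it; the identification and the END survive -/

section AtRecord

/-- **v3's `RemAt F κ θ hP` (linear form, spelled VERBATIM from the registered skeleton v3 :172) ⟹ THE CONSTANT-FORM PACKAGE `RemAtC`** («some box `]0,γ₀] ⊆ ]0,θ.γ]`,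
a constant `0 ≤ s ≤ stepBal 2 F.L` with `|β_{k+1}(p) − beta0OfJs F κ k| ≤ s` on it, a per-scale anchor at `beta0OfJs F κ`, (C) and the upper bound») — so a stub cut on `RemAtC`
is WEAKER than the registered `stub_remNamedJets13`. [cite: Balaban1987RG1, (5.10) p.293, (1.22) p.264 and (2.13) p.268] -/
theorem remAtC_of_remAt (F : T4Family) (κ : StepColourData) (θ : Node00.Stage13HParams F 2) (hP : θ.Provisos₁₃SepCoPH F 2)
    (h : ∃ γ₀ Cr β' : ℝ, 0 < γ₀ ∧ γ₀ ≤ θ.γ ∧ 0 ≤ Cr ∧ 0 ≤ β' ∧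
      BoxRemainder (Node00.datumOfRecord₁₃SepCoPH F 2 θ hP).βfun (beta0OfJs F κ) Cr γ₀ ∧
      Cr * γ₀ ≤ B12Normalization.stepBal 2 F.L ∧
      BetaContH γ₀ (Node00.datumOfRecord₁₃SepCoPH F 2 θ hP).βfun ∧
      BetaUpperH β' γ₀ (Node00.datumOfRecord₁₃SepCoPH F 2 θ hP).βfun) :
    ∃ γ₀ s β' : ℝ, 0 < γ₀ ∧ γ₀ ≤ θ.γ ∧ 0 ≤ s ∧ s ≤ B12Normalization.stepBal 2 F.L ∧ 0 ≤ β' ∧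
      (∀ (k : ℕ) (p : Fin (k + 1) → ℝ), p ∈ HistBox γ₀ k → |(Node00.datumOfRecord₁₃SepCoPH F 2 θ hP).βfun k p - beta0OfJs F κ k| ≤ s) ∧
      (∀ (k : ℕ) (δ : ℝ), 0 < δ → ∃ γ : ℝ, 0 < γ ∧ ∀ p : Fin (k + 1) → ℝ, p ∈ HistBox γ k →
        |(Node00.datumOfRecord₁₃SepCoPH F 2 θ hP).βfun k p - beta0OfJs F κ k| ≤ δ) ∧
      BetaContH γ₀ (Node00.datumOfRecord₁₃SepCoPH F 2 θ hP).βfun ∧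
      BetaUpperH β' γ₀ (Node00.datumOfRecord₁₃SepCoPH F 2 θ hP).βfun := by
  obtain ⟨γ₀, Cr, β', hγ₀, hle, hCr, hβ', hrem, hseam, hcont, hup⟩ := h
  exact ⟨γ₀, Cr * γ₀, β', hγ₀, hle, mul_nonneg hCr hγ₀.le, hseam, hβ', constRemainder_of_boxRemainder hrem hCr,
    anchor_of_boxRemainder hrem hCr hγ₀, hcont, hup⟩

/-- **THE IDENTIFICATION SURVIVES THE WEAKENING**: two colour data whose constant-form packages hold at the same admissible tuple have the SAME named one-loop numbers
(`eq_of_anchors` on the two per-scale anchors) — so under `RemAtC` the colour datum `κ` is no free knob either (v3's reason for the linear form, `boxRemainder_unique`, is kept).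
[cite: Balaban1987RG1, (2.13) p.268 and (1.22) p.264] -/
theorem beta0OfJs_eq_of_remAtC (F : T4Family) (κ κ' : StepColourData) (θ : Node00.Stage13HParams F 2) (hP : θ.Provisos₁₃SepCoPH F 2)
    (h : ∃ γ₀ s β' : ℝ, 0 < γ₀ ∧ γ₀ ≤ θ.γ ∧ 0 ≤ s ∧ s ≤ B12Normalization.stepBal 2 F.L ∧ 0 ≤ β' ∧
      (∀ (k : ℕ) (p : Fin (k + 1) → ℝ), p ∈ HistBox γ₀ k → |(Node00.datumOfRecord₁₃SepCoPH F 2 θ hP).βfun k p - beta0OfJs F κ k| ≤ s) ∧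
      (∀ (k : ℕ) (δ : ℝ), 0 < δ → ∃ γ : ℝ, 0 < γ ∧ ∀ p : Fin (k + 1) → ℝ, p ∈ HistBox γ k →
        |(Node00.datumOfRecord₁₃SepCoPH F 2 θ hP).βfun k p - beta0OfJs F κ k| ≤ δ) ∧
      BetaContH γ₀ (Node00.datumOfRecord₁₃SepCoPH F 2 θ hP).βfun ∧
      BetaUpperH β' γ₀ (Node00.datumOfRecord₁₃SepCoPH F 2 θ hP).βfun)
    (h' : ∃ γ₀ s β' : ℝ, 0 < γ₀ ∧ γ₀ ≤ θ.γ ∧ 0 ≤ s ∧ s ≤ B12Normalization.stepBal 2 F.L ∧ 0 ≤ β' ∧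
      (∀ (k : ℕ) (p : Fin (k + 1) → ℝ), p ∈ HistBox γ₀ k → |(Node00.datumOfRecord₁₃SepCoPH F 2 θ hP).βfun k p - beta0OfJs F κ' k| ≤ s) ∧
      (∀ (k : ℕ) (δ : ℝ), 0 < δ → ∃ γ : ℝ, 0 < γ ∧ ∀ p : Fin (k + 1) → ℝ, p ∈ HistBox γ k →
        |(Node00.datumOfRecord₁₃SepCoPH F 2 θ hP).βfun k p - beta0OfJs F κ' k| ≤ δ) ∧
      BetaContH γ₀ (Node00.datumOfRecord₁₃SepCoPH F 2 θ hP).βfun ∧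
      BetaUpperH β' γ₀ (Node00.datumOfRecord₁₃SepCoPH F 2 θ hP).βfun) :
    beta0OfJs F κ = beta0OfJs F κ' := by
  obtain ⟨-, -, -, -, -, -, -, -, -, hanchor, -, -⟩ := h
  obtain ⟨-, -, -, -, -, -, -, -, -, hanchor', -, -⟩ := h'
  exact eq_of_anchors hanchor hanchor'

/-- **★★ LINE 1″'s COMPOSITION (kernel, no sorry): {stub 1″ `D1AtShadowingJetsC` (row (D1) carried by the named jets, hypothesis = the CONSTANT-form package), stub 2″
`RemAtCSomeJets` (∃ κ, ∀ admissible θ, the constant-form package)} ⟹ K2⁷'s TEXT** (verbatim, as v3's `_of_shadowingJets`) — the package is opened ONCE; its constant remainder,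
seam, (C) and upper bound feed `endpointExistence_of_drift_constRemainder` at the datum's `fwd`; its whole feeds stub 1″.  Same shape as v3's line 1′ with the (D4)-side ONE located
estimate cheaper ((P1) off the path). [cite: Balaban1987RG1, Thm 2 p.259 (first sentence), (5.10) p.293 and (2.12)–(2.14) p.268] -/
theorem EndpointGivenBR13SepCoPH_text_of_line1C
    (h₁ : ∀ (F : T4Family) (κ : StepColourData) (θ : Node00.Stage13HParams F 2) (hP : θ.Provisos₁₃SepCoPH F 2), θ.Admissible F 2 →
      (∃ γ₀ s β' : ℝ, 0 < γ₀ ∧ γ₀ ≤ θ.γ ∧ 0 ≤ s ∧ s ≤ B12Normalization.stepBal 2 F.L ∧ 0 ≤ β' ∧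
        (∀ (k : ℕ) (p : Fin (k + 1) → ℝ), p ∈ HistBox γ₀ k → |(Node00.datumOfRecord₁₃SepCoPH F 2 θ hP).βfun k p - beta0OfJs F κ k| ≤ s) ∧
        (∀ (k : ℕ) (δ : ℝ), 0 < δ → ∃ γ : ℝ, 0 < γ ∧ ∀ p : Fin (k + 1) → ℝ, p ∈ HistBox γ k →
          |(Node00.datumOfRecord₁₃SepCoPH F 2 θ hP).βfun k p - beta0OfJs F κ k| ≤ δ) ∧
        BetaContH γ₀ (Node00.datumOfRecord₁₃SepCoPH F 2 θ hP).βfun ∧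
        BetaUpperH β' γ₀ (Node00.datumOfRecord₁₃SepCoPH F 2 θ hP).βfun) →
      ∃ A : ℝ, OneLoopDrift (B12Normalization.stepBal 2 F.L) A (beta0OfJs F κ))
    (h₂ : ∀ F : T4Family, ∃ κ : StepColourData, ∀ (θ : Node00.Stage13HParams F 2) (hP : θ.Provisos₁₃SepCoPH F 2), θ.Admissible F 2 →
      ∃ γ₀ s β' : ℝ, 0 < γ₀ ∧ γ₀ ≤ θ.γ ∧ 0 ≤ s ∧ s ≤ B12Normalization.stepBal 2 F.L ∧ 0 ≤ β' ∧
        (∀ (k : ℕ) (p : Fin (k + 1) → ℝ), p ∈ HistBox γ₀ k → |(Node00.datumOfRecord₁₃SepCoPH F 2 θ hP).βfun k p - beta0OfJs F κ k| ≤ s) ∧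
        (∀ (k : ℕ) (δ : ℝ), 0 < δ → ∃ γ : ℝ, 0 < γ ∧ ∀ p : Fin (k + 1) → ℝ, p ∈ HistBox γ k →
          |(Node00.datumOfRecord₁₃SepCoPH F 2 θ hP).βfun k p - beta0OfJs F κ k| ≤ δ) ∧
        BetaContH γ₀ (Node00.datumOfRecord₁₃SepCoPH F 2 θ hP).βfun ∧
        BetaUpperH β' γ₀ (Node00.datumOfRecord₁₃SepCoPH F 2 θ hP).βfun) :
    (∀ (F : Literature.MathematicalPhysics.QuantumFieldTheory.Balaban1983to89.T4Continuum.T4Family) (θ : Literature.MathematicalPhysics.QuantumFieldTheory.Balaban1983to89.Node00.Stage13HParams F 2) (h : θ.Provisos₁₃SepCoPH F 2), (θ.ZhUnity F 2 ∧ θ.SlotsNondegenerate₁₃ F 2) → θ.Admissible F 2 → Literature.MathematicalPhysics.QuantumFieldTheory.Balaban1983to89.B16.EndStatementBPrinted (Literature.MathematicalPhysics.QuantumFieldTheory.Balaban1983to89.Node00.datumOfRecord₁₃SepCoPH F 2 θ h).C → (∃ γ₁ : ℝ, 0 < γ₁ ∧ ∀ γ : ℝ, 0 < γ → γ ≤ γ₁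 → ∃ P : Literature.MathematicalPhysics.QuantumFieldTheory.Balaban1983to89.B12.RunParams, 1 ≤ P.K ∧ ((Literature.MathematicalPhysics.QuantumFieldTheory.Balaban1983to89.Node00.datumOfRecord₁₃SepCoPH F 2 θ h).C P).flow.InInterval γ P.K) → Literature.MathematicalPhysics.QuantumFieldTheory.Balaban1983to89.DagBinding.EndpointExistence (Literature.MathematicalPhysics.QuantumFieldTheory.Balaban1983to89.Node00.datumOfRecord₁₃SepCoPH F 2 θ h).C.toB12) := by
  intro F θ hP _hU hθ _hB _hwin
  obtain ⟨κ, hκ⟩ := h₂ F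
  have hRem := hκ θ hP hθ
  obtain ⟨A, hdrift⟩ := h₁ F κ θ hP hθ hRem
  obtain ⟨γ₀, s, β', hγ₀, -, -, hseam, hβ', hrem, -, hcont, hup⟩ := hRem
  exact endpointExistence_of_drift_constRemainder (Node00.datumOfRecord₁₃SepCoPH F 2 θ hP).fwd hγ₀ hdrift hrem hseam hβ' hcont hup

/-- USE FORM for the row-(D1) owner (as v3's `d1AtShadowingJets_of_d1Drift_all`): a (D1) theorem «row D1 at EVERY colour datum» discharges stub 1″; the constant-form
hypothesis is then simply unused — 1″ has the same (D1) discharge road as 1′. [folklore] -/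
theorem d1AtShadowingJetsC_of_d1Drift_all
    (h : ∀ (F : T4Family) (κ : StepColourData), ∃ A : ℝ, OneLoopDrift (B12Normalization.stepBal 2 F.L) A (beta0OfJs F κ)) :
    ∀ (F : T4Family) (κ : StepColourData) (θ : Node00.Stage13HParams F 2) (hP : θ.Provisos₁₃SepCoPH F 2), θ.Admissible F 2 →
      (∃ γ₀ s β' : ℝ, 0 < γ₀ ∧ γ₀ ≤ θ.γ ∧ 0 ≤ s ∧ s ≤ B12Normalization.stepBal 2 F.L ∧ 0 ≤ β' ∧
        (∀ (k : ℕ) (p : Fin (k + 1) → ℝ), p ∈ HistBox γ₀ k → |(Node00.datumOfRecord₁₃SepCoPH F 2 θ hP).βfun k p - beta0OfJs F κ k| ≤ s) ∧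
        (∀ (k : ℕ) (δ : ℝ), 0 < δ → ∃ γ : ℝ, 0 < γ ∧ ∀ p : Fin (k + 1) → ℝ, p ∈ HistBox γ k →
          |(Node00.datumOfRecord₁₃SepCoPH F 2 θ hP).βfun k p - beta0OfJs F κ k| ≤ δ) ∧
        BetaContH γ₀ (Node00.datumOfRecord₁₃SepCoPH F 2 θ hP).βfun ∧
        BetaUpperH β' γ₀ (Node00.datumOfRecord₁₃SepCoPH F 2 θ hP).βfun) →
      ∃ A : ℝ, OneLoopDrift (B12Normalization.stepBal 2 F.L) A (beta0OfJs F κ) :=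
  fun F κ _θ _hP _hθ _h => h F κ

/-- LINE 1′ ⟹ LINE 1″ on the (D4) side: v3's registered `RemAtSomeJets` text (VERBATIM) gives stub 2″ `RemAtCSomeJets` (`remAtC_of_remAt`) — the proposed cut is a WEAKENING
of the registered one (nothing a supplier of 2′ loses). [folklore] -/
theorem remAtCSomeJets_of_remAtSomeJets
    (h : ∀ F : T4Family, ∃ κ : StepColourData, ∀ (θ : Node00.Stage13HParams F 2) (hP : θ.Provisos₁₃SepCoPH F 2), θ.Admissible F 2 →
      ∃ γ₀ Cr β' : ℝ, 0 < γ₀ ∧ γ₀ ≤ θ.γ ∧ 0 ≤ Cr ∧ 0 ≤ β' ∧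
        BoxRemainder (Node00.datumOfRecord₁₃SepCoPH F 2 θ hP).βfun (beta0OfJs F κ) Cr γ₀ ∧
        Cr * γ₀ ≤ B12Normalization.stepBal 2 F.L ∧
        BetaContH γ₀ (Node00.datumOfRecord₁₃SepCoPH F 2 θ hP).βfun ∧
        BetaUpperH β' γ₀ (Node00.datumOfRecord₁₃SepCoPH F 2 θ hP).βfun) :
    ∀ F : T4Family, ∃ κ : StepColourData, ∀ (θ : Node00.Stage13HParams F 2) (hP : θ.Provisos₁₃SepCoPH F 2), θ.Admissible F 2 →
      ∃ γ₀ s β' : ℝ, 0 < γ₀ ∧ γ₀ ≤ θ.γ ∧ 0 ≤ s ∧ s ≤ B12Normalization.stepBal 2 F.L ∧ 0 ≤ β' ∧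
        (∀ (k : ℕ) (p : Fin (k + 1) → ℝ), p ∈ HistBox γ₀ k → |(Node00.datumOfRecord₁₃SepCoPH F 2 θ hP).βfun k p - beta0OfJs F κ k| ≤ s) ∧
        (∀ (k : ℕ) (δ : ℝ), 0 < δ → ∃ γ : ℝ, 0 < γ ∧ ∀ p : Fin (k + 1) → ℝ, p ∈ HistBox γ k →
          |(Node00.datumOfRecord₁₃SepCoPH F 2 θ hP).βfun k p - beta0OfJs F κ k| ≤ δ) ∧
        BetaContH γ₀ (Node00.datumOfRecord₁₃SepCoPH F 2 θ hP).βfun ∧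
        BetaUpperH β' γ₀ (Node00.datumOfRecord₁₃SepCoPH F 2 θ hP).βfun := by
  intro F
  obtain ⟨κ, hκ⟩ := h F
  exact ⟨κ, fun θ hP hθ => remAtC_of_remAt F κ θ hP (hκ θ hP hθ)⟩

end AtRecord

end Summit.QuantumFields.YangMills.Theorems.BalabanUVNodesK2Line1PrimeRemainderPrice

end
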